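import Summits.MatrixMultiplication.MatrixMultiplication.Theorems.AbelianSTPPCensusShapeCertVPSpec

/-!
# Abelian STPP census — soundness of `ShapeCertVP` (part 4b: the bounds and the kill)

Cell mm-stpp, route `AbelianSTPPCensusVP`, crux `ShapeExclusionVP337` (stmt-MatrixMultiplication-19191); seat mm-stpp-theory.
For an admissible family `G` (vM system `AdmM` and rule U11-G in credit form `AdmG`, inside the universe of an order
`M ≤ 337`) above a prefix `fam`, whose tail members all have ratio level `≤ L` or `≤ 27`:
* PACKING RATIO BOUND (`AboveV.gsum_le_bnd`, `AboveV.not_beat_of_R`): `K·gain(G) ≤ K·gain(fam) + tabR L (kOf) · q0` —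
  eng-2's continuation bound with the suffix maxima replaced by the static level table;
* FIRST-MEMBER BOUND (`AboveV.not_beat_of_first`): with a tail member `t`, additionally `Σ_tail uu ≤ (3M + a_t+b_t+c_t)/2 −
  uu(fam) − uu(t)` (rule U11 at `t`);
* GRYNKIEWICZ BOUND (`AboveV.wh_sum_le`, `AboveV.tail_eq_zero_of_bud`, `AboveV.gsum_le_G`, `AboveV.not_beat_of_G`,
  `AboveV.not_beat_of_empty`): for `(r,t)` admissible for the prefix with budget `b`, `Σ_tail ŵ_t ≤ b`; the tail is empty
  when `b ≤ 2t`; and `K·gain(tail) ≤ b · tabG L (i)`;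
* KILL (`not_admG_of_killV`): a kill at an admissible `(r,t)` refutes `AdmG` of the prefix, hence of `G` (heredity);
* TOP LEVEL (`gsum_le_of_low`): a family all of whose members have level `≤ 27` does not beat (rule U11 at one member
  and the level-27 ratio table: `0.4375 · 2.25 < 1`).
-/

set_option linter.dupNamespace false -- `MatrixMultiplication.MatrixMultiplication` (summit = problem, D-0017)
set_option autoImplicit false

namespace Summit.MatrixMultiplication.MatrixMultiplication.Theorems.ShapeCertVP

open ShapeCert Multiset

section bounds
/-! ### The bounds for an admissible family above a prefix -/

variable {M : ℕ} {G : Multiset (ℕ × ℕ × ℕ)} {fam : List Sh}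

/-- the gain of the family splits into prefix and tail -/
theorem AboveV.gsum_split (h : AboveV M G fam) : gsumV G = gs fam + gsumV (G - famT fam) := by
  unfold gsumV; rw [gs_eqV h.wf]; exact sum_map_split h.le _

/-- **packing ratio bound with the level table**: if every tail member has level `≤ L` or `≤ 27` then
`K·gain(G) ≤ K·gain(fam) + bnd` with eng-2's continuation bound read at `tabR L` -/
theorem AboveV.gsum_le_bnd (h : AboveV M G fam) {L : ℕ} (hL : ∀ x ∈ G - famT fam, levT x ≤ 27 ∨ levT x ≤ L) :
    gsumV G * K ≤ gs fam * K + (aggOf M fam).bnd M (tabR L) := by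
  rw [h.gsum_split, Nat.add_mul]
  by_cases hd : (aggOf M fam).dead M = true
  · rw [h.tail_eq_zero_of_dead hd]; simp [gsumV]
  rw [Agg.bnd, if_neg hd]
  apply Nat.add_le_add_left
  have hq := h.tail_uu
  calc gsumV (G - famT fam) * K
      = ((G - famT fam).map fun x => gT x * K).sum := by unfold gsumV; rw [Multiset.sum_map_mul_right]
    _ ≤ ((G - famT fam).map fun x => (tabR L).get ((aggOf M fam).kOf M) * uu x).sum := by
        apply Multiset.sum_map_le_sum_map
        intro x hx
        have hU := h.univ x (mem_G_of_tail hx)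
        exact (gT_mul_le_rho hU).trans (Nat.mul_le_mul_right _
          (rhoT_le_tabR' h.hM hU (hL x hx) (h.tail_capOK hx)))
    _ = (tabR L).get ((aggOf M fam).kOf M) * ((G - famT fam).map uu).sum := by rw [Multiset.sum_map_mul_left]
    _ ≤ (tabR L).get ((aggOf M fam).kOf M) * (aggOf M fam).q0 M := Nat.mul_le_mul_left _ hq

/-- no beating family through a prefix whose table bound closes -/
theorem AboveV.not_beat_of_R (h : AboveV M G fam) {L : ℕ} (hL : ∀ x ∈ G - famT fam, levT x ≤ 27 ∨ levT x ≤ L)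
    (hle : gs fam * K + (aggOf M fam).bnd M (tabR L) ≤ M * D * K) : ¬ M * D < gsumV G := by
  have := (h.gsum_le_bnd hL).trans hle
  have := Nat.le_of_mul_le_mul_right this (show 0 < K by decide)
  omega

/-- the `bnd` form of a closing test `g0 + sel (tabR L) · q0 ≤ mdk` -/
theorem bnd_le_of_test {A : Agg} {M L : ℕ} (h : A.gs * K + selOf (A.kOf M) (tabR L) * A.q0 M ≤ M * D * K) :
    A.gs * K + A.bnd M (tabR L) ≤ M * D * K := by
  unfold Agg.bnd; split_ifs
  · simpa using (Nat.le_add_right _ _).trans h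
  · rw [selOf_eq] at h; exact h

/-- **first-member bound**: with the candidate `t` a tail member of level `L`, all other tail members of level `≤ L`
or `≤ 27`, the gain of `G` is at most prefix + `t` + `tabR L (kOf) · min(q0, (3M + a+b+c)/2 − uu(fam) − uu(t))` -/
theorem AboveV.not_beat_of_first (h : AboveV M G fam) {t : Sh} (ht : t.tr ∈ G - famT fam) (hwt : t = shV M t.tr)
    (hL : ∀ x ∈ G - famT fam, levT x ≤ 27 ∨ levT x ≤ t.lev)
    (hle : gs fam * K + t.g * K + selOf ((aggOf M fam).kOf M) (tabR t.lev) *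
      min ((aggOf M fam).q0 M) ((3 * M + (t.a + t.b + t.c)) / 2 - uuA (aggOf M fam) - (t.ab + t.bc + t.ca)) ≤ M * D * K) :
    ¬ M * D < gsumV G := by
  intro hbeat
  -- split the family: prefix, the member `t`, the rest
  have hle1 : famT (t :: fam) ≤ G := cons_le_of_mem_sub h.le ht
  have hwf1 : WfV M (t :: fam) := by
    intro s hs; rcases List.mem_cons.mp hs with rfl | hs
    · exact hwt
    · exact h.wf s hs
  have h1 : AboveV M G (t :: fam) := ⟨h.hM, h.univ, h.adm, h.admG, hwf1, hle1⟩
  have hsplit := h1.gsum_split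
  have hgs : gs (t :: fam) = t.g + gs fam := rfl
  have hsub : G - famT (t :: fam) ≤ G - famT fam := sub_cons_le _ _ _
  -- the rest's gain against its packing weight
  have hB : ∀ x ∈ G - famT (t :: fam), gT x * K ≤ selOf ((aggOf M fam).kOf M) (tabR t.lev) * uu x := by
    intro x hx
    have hx' : x ∈ G - famT fam := Multiset.mem_of_le hsub hx
    have hU := h.univ x (mem_G_of_tail hx')
    rw [selOf_eq]
    exact (gT_mul_le_rho hU).trans (Nat.mul_le_mul_right _ (rhoT_le_tabR' h.hM hU (hL x hx') (h.tail_capOK hx')))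
  have hgT : gsumV (G - famT (t :: fam)) * K ≤
      selOf ((aggOf M fam).kOf M) (tabR t.lev) * ((G - famT (t :: fam)).map uu).sum := by
    unfold gsumV; rw [← Multiset.sum_map_mul_right, ← Multiset.sum_map_mul_left]
    exact Multiset.sum_map_le_sum_map _ _ hB
  -- the rest's packing weight: eng-2's budget and rule U11 at `t`
  have hq1 : ((G - famT (t :: fam)).map uu).sum ≤ (aggOf M fam).q0 M := (sum_map_le_of_le hsub uu).trans h.tail_uu
  have hq2 : ((G - famT (t :: fam)).map uu).sum ≤
      (3 * M + (t.a + t.b + t.c)) / 2 - uuA (aggOf M fam) - (t.ab + t.bc + t.ca) := by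
    have h2 := two_sum_uu_le h.adm (mem_G_of_tail ht)
    rw [sum_map_split hle1 uu] at h2
    have ef : ((famT (t :: fam)).map uu).sum = uu t.tr + ((famT fam).map uu).sum := by
      rw [famT_cons]; simp
    rw [ef, ← uuA_aggOf h.wf] at h2
    have e1 : t.a = t.tr.1 := rfl
    have e2 : t.b = t.tr.2.1 := rfl
    have e3 : t.c = t.tr.2.2 := rfl
    have e4 : t.ab + t.bc + t.ca = uu t.tr := by
      rw [hwt]; simp [uu]
    have h3 : uu t.tr + uuA (aggOf M fam) + ((G - famT (t :: fam)).map uu).sum ≤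
        (3 * M + (t.tr.1 + t.tr.2.1 + t.tr.2.2)) / 2 := by
      rw [Nat.le_div_iff_mul_le (by norm_num)]; omega
    rw [e1, e2, e3, e4]; omega
  have hq : ((G - famT (t :: fam)).map uu).sum ≤
      min ((aggOf M fam).q0 M) ((3 * M + (t.a + t.b + t.c)) / 2 - uuA (aggOf M fam) - (t.ab + t.bc + t.ca)) :=
    le_min hq1 hq2
  have : gsumV G * K ≤ M * D * K := by
    rw [hsplit, hgs]
    calc (t.g + gs fam + gsumV (G - famT (t :: fam))) * K
        = gs fam * K + t.g * K + gsumV (G - famT (t :: fam)) * K := by ring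
      _ ≤ gs fam * K + t.g * K + selOf ((aggOf M fam).kOf M) (tabR t.lev) *
          min ((aggOf M fam).q0 M) ((3 * M + (t.a + t.b + t.c)) / 2 - uuA (aggOf M fam) - (t.ab + t.bc + t.ca)) :=
          Nat.add_le_add_left (hgT.trans (Nat.mul_le_mul_left _ hq)) _
      _ ≤ M * D * K := hle
  have := Nat.le_of_mul_le_mul_right this (show 0 < K by decide)
  omega

/-- **the Grynkiewicz budget**: for `(r, t)` admissible for the prefix, the tail weights fit the budget -/
theorem AboveV.wh_sum_le (h : AboveV M G fam) {r t : ℕ} (hrt : admRT r t (aggOf M fam) fam = true) :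
    ((G - famT fam).map fun x => whT x t).sum ≤
      t * M + 2 * (t * t) - 1 + crS r t fam - t * uuA (aggOf M fam) := by
  obtain ⟨h3, hp1, hp2, hfib⟩ := admRT_spec h.wf hrt
  have hG := h.admG r t h3 (hp1.trans (sum_map_le_of_le h.le _)) (hp2.trans (sum_map_le_of_le h.le _))
    (hfib.trans (sum_map_le_of_le h.le _))
  rw [sum_map_split h.le uu, sum_map_split h.le (crT r t)] at hG
  have hwc : ((G - famT fam).map fun x => whT x t).sum + ((G - famT fam).map (crT r t)).sum ≤
      t * ((G - famT fam).map uu).sum := by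
    rw [← Multiset.sum_map_add, ← Multiset.sum_map_mul_left]
    exact Multiset.sum_map_le_sum_map _ _ fun x _ => whT_add_crT_le r t x
  rw [crS_eq h.wf, uuA_aggOf h.wf]
  have e : t * (((famT fam).map uu).sum + ((G - famT fam).map uu).sum) =
      t * ((famT fam).map uu).sum + t * ((G - famT fam).map uu).sum := by ring
  rw [e] at hG
  have h9 : 9 ≤ t * t := Nat.mul_le_mul h3 h3
  omega

/-- a budget of at most `2t` leaves no room for a tail member -/
theorem AboveV.tail_eq_zero_of_bud (h : AboveV M G fam) {r t : ℕ} (hrt : admRT r t (aggOf M fam) fam = true)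
    (hb : t * M + 2 * (t * t) - 1 + crS r t fam - t * uuA (aggOf M fam) ≤ 2 * t) : G - famT fam = 0 := by
  rcases Multiset.empty_or_exists_mem (G - famT fam) with h0 | ⟨x, hx⟩
  · exact h0
  exfalso
  have h3 := (admRT_spec h.wf hrt).1
  obtain ⟨p1, p2, p3⟩ := (h.univ x (mem_G_of_tail hx)).pos
  have hw := whT_ge (by omega : 2 ≤ t) p1 p2 p3
  have hle : whT x t ≤ ((G - famT fam).map fun x => whT x t).sum :=
    Multiset.le_sum_of_mem (Multiset.mem_map_of_mem (fun x => whT x t) hx)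
  have := h.wh_sum_le hrt
  omega

/-- **Grynkiewicz continuation bound with the level table** -/
theorem AboveV.gsum_le_G (h : AboveV M G fam) {r i : ℕ} (hrt : admRT r (tOf i) (aggOf M fam) fam = true)
    {L : ℕ} (hL : ∀ x ∈ G - famT fam, levT x ≤ 27 ∨ levT x ≤ L) :
    gsumV G * K ≤ gs fam * K +
      (tOf i * M + 2 * (tOf i * tOf i) - 1 + crS r (tOf i) fam - tOf i * uuA (aggOf M fam)) * (tabG L).get i := by
  rw [h.gsum_split, Nat.add_mul]
  apply Nat.add_le_add_left
  have h3 := (admRT_spec h.wf hrt).1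
  calc gsumV (G - famT fam) * K
      = ((G - famT fam).map fun x => gT x * K).sum := by unfold gsumV; rw [Multiset.sum_map_mul_right]
    _ ≤ ((G - famT fam).map fun x => (tabG L).get i * whT x (tOf i)).sum := by
        apply Multiset.sum_map_le_sum_map
        intro x hx
        have hU := h.univ x (mem_G_of_tail hx)
        obtain ⟨p1, p2, p3⟩ := hU.pos
        have hw := whT_ge (by omega : 2 ≤ tOf i) p1 p2 p3
        exact (gT_mul_le_qh (by omega)).trans (Nat.mul_le_mul_right _ (qhT_le_tabG' h.hM hU (hL x hx) i))
    _ = (tabG L).get i * ((G - famT fam).map fun x => whT x (tOf i)).sum := by rw [Multiset.sum_map_mul_left]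
    _ ≤ (tabG L).get i *
          (tOf i * M + 2 * (tOf i * tOf i) - 1 + crS r (tOf i) fam - tOf i * uuA (aggOf M fam)) :=
        Nat.mul_le_mul_left _ (h.wh_sum_le hrt)
    _ = _ := Nat.mul_comm _ _

/-- no beating family through a prefix whose Grynkiewicz bound closes (budget index `i` with budget `b`) -/
theorem AboveV.not_beat_of_G (h : AboveV M G fam) {i b : ℕ} (hb : (budsOf M (aggOf M fam) fam).get i = some b)
    {L : ℕ} (hL : ∀ x ∈ G - famT fam, levT x ≤ 27 ∨ levT x ≤ L)
    (hle : gs fam * K + b * (tabG L).get i ≤ M * D * K) : ¬ M * D < gsumV G := by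
  rw [budsOf_get] at hb
  obtain ⟨r, hrt, rfl⟩ := budT_some hb
  have := (h.gsum_le_G hrt hL).trans hle
  have := Nat.le_of_mul_le_mul_right this (show 0 < K by decide)
  omega

/-- no beating family through a prefix with an exhausted budget (and non-beating prefix gain) -/
theorem AboveV.not_beat_of_empty (h : AboveV M G fam) {i b : ℕ} (hb : (budsOf M (aggOf M fam) fam).get i = some b)
    (hsmall : b ≤ 2 * tOf i) (hgs : gs fam ≤ M * D) : ¬ M * D < gsumV G := by
  rw [budsOf_get] at hb
  obtain ⟨r, hrt, rfl⟩ := budT_some hb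
  have h0 := h.tail_eq_zero_of_bud hrt hsmall
  rw [h.gsum_split, h0]; simp [gsumV]; omega

/-- **the kill is sound**: a kill at `(r, t)` refutes rule U11-G (credit form) for the prefix -/
theorem not_admG_of_killAt {r t : ℕ} (hw : WfV M fam) (h : killAt M r t (aggOf M fam) fam = true) :
    ¬ AdmG M (famT fam) := by
  intro hA
  unfold killAt at h
  rw [Bool.and_eq_true, decide_eq_true_eq] at h
  obtain ⟨h3, hp1, hp2, hfib⟩ := admRT_spec hw h.1
  have := hA r t h3 hp1 hp2 hfib
  have h9 : 9 ≤ t * t := Nat.mul_le_mul h3 h3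
  rw [crS_eq hw, uuA_aggOf hw] at h
  omega

/-- the kill test of a form refutes rule U11-G for the prefix -/
theorem not_admG_of_killForm {r : ℕ} (hw : WfV M fam) (h : killForm M r (aggOf M fam) fam = true) :
    ¬ AdmG M (famT fam) := by
  unfold killForm at h
  simp only [seqN_eq, Bool.or_eq_true] at h
  rcases h with ((h | h) | h) | h <;> exact not_admG_of_killAt hw h

/-- the kill test refutes rule U11-G for the prefix -/
theorem not_admG_of_killV (hw : WfV M fam) (h : killV M (aggOf M fam) fam = true) : ¬ AdmG M (famT fam) := by
  unfold killV at h
  simp only [seqN_eq, Bool.and_eq_true, Bool.or_eq_true] at h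
  rcases h.2 with (h' | h') | h' <;> exact not_admG_of_killForm hw h'

/-- **top level**: a family inside the universe satisfying rule U11, all of whose members have ratio level `≤ 27`,
does not beat -/
theorem gsum_le_of_low (hM : M ≤ 337) (hU : ∀ x ∈ G, InUniv M x) (hA : AdmM M G) (hlow : ∀ x ∈ G, levT x ≤ 27) :
    ¬ M * D < gsumV G := by
  rcases Multiset.empty_or_exists_mem G with h0 | ⟨t, ht⟩
  · subst h0; simp [gsumV]
  intro hbeat
  have h2 := two_sum_uu_le hA ht
  have hs : t.1 + t.2.1 + t.2.2 ≤ 3 * (M / 2) := by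
    have hx := hU t ht
    have hv := hx.vol_le
    obtain ⟨p1, p2, p3⟩ := hx.pos
    have ha : t.1 ≤ vol t := by
      unfold vol; calc t.1 = t.1 * 1 * 1 := by ring
        _ ≤ t.1 * t.2.1 * t.2.2 := Nat.mul_le_mul (Nat.mul_le_mul_left _ p2) p3
    have hb : t.2.1 ≤ vol t := by
      unfold vol; calc t.2.1 = 1 * t.2.1 * 1 := by ring
        _ ≤ t.1 * t.2.1 * t.2.2 := Nat.mul_le_mul (Nat.mul_le_mul_right _ p1) p3
    have hc : t.2.2 ≤ vol t := by
      unfold vol; calc t.2.2 = 1 * 1 * t.2.2 := by ring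
        _ ≤ t.1 * t.2.1 * t.2.2 := Nat.mul_le_mul_right _ (Nat.mul_le_mul p1 p2)
    have m1 := le_max_left t.1 (max t.2.1 t.2.2)
    have m2 := (le_max_left t.2.1 t.2.2).trans (le_max_right t.1 (max t.2.1 t.2.2))
    have m3 := (le_max_right t.2.1 t.2.2).trans (le_max_right t.1 (max t.2.1 t.2.2))
    have : t.1 ≤ M / 2 := by rw [Nat.le_div_iff_mul_le (by norm_num)]; omega
    have : t.2.1 ≤ M / 2 := by rw [Nat.le_div_iff_mul_le (by norm_num)]; omega
    have : t.2.2 ≤ M / 2 := by rw [Nat.le_div_iff_mul_le (by norm_num)]; omega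
    omega
  have hq : (G.map uu).sum ≤ (3 * M + 3 * (M / 2)) / 2 := by
    rw [Nat.le_div_iff_mul_le (by norm_num)]; omega
  have hR : gsumV G * K ≤ (tabR 27).get 7 * (G.map uu).sum := by
    unfold gsumV; rw [← Multiset.sum_map_mul_right, ← Multiset.sum_map_mul_left]
    apply Multiset.sum_map_le_sum_map
    intro x hx
    have hU' := hU x hx
    exact (gT_mul_le_rho hU').trans
      (Nat.mul_le_mul_right _ (rhoT_le_tabR hM hU' (hlow x hx) (capOK_seven_le le_rfl)))
  have := (hR.trans (Nat.mul_le_mul_left _ hq)).trans (low_num M hM)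
  have := Nat.le_of_mul_le_mul_right this (show 0 < K by decide)
  omega

end bounds

end Summit.MatrixMultiplication.MatrixMultiplication.Theorems.ShapeCertVP
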